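import Summits.CriticalPhenomena.PercolationContinuityZ3.Theorems.PercNearOneGluingNoHeavyLowerTailKNGoodOneLayerExpansion
import Summits.CriticalPhenomena.PercolationContinuityZ3.Theorems.PercNearOneGluingNoHeavyLowerTailKernelCorners
import HarnessLib

/-!
# The goodness functional of a THREE-port one-layer observer, written out (eight patterns, forced margins evaluated)
# (`NoHeavyLowerTail` cell, stmt-CriticalPhenomena-4575; prover `prim-hp-2`, deletion–contraction line, gen 12)

Support file (`--supports stmt-CriticalPhenomena-4575`).  No definitions, no named facts, no sorries.
Memo: `run/shared/lean/prim/prim-hp-2/MEMO-gen12-gc-three-relays.md` §7 (phases 3–4 of the three-relay GC assembly).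

* `KNGoodGC3.sum_pattern_three` — the pattern law of a three-port star written out (eight terms).
* `KNGoodGC3.agood_threePort_ge` — for a one-layer observer `x` with ports `a₁, a₂, a₃` (hairs `H_i`) over the core `K`:
  `agood(N, x; j) ≥ Σ_B π_H(B)·V(B)` with `V(∅) = min_a μ_K(a↔b) − μ_K(j↔b)`, `V({a}) = μ_K(a↔b) − μ_K(j↔b)`,
  `V({a,a'}) = μ_{K[aa'↦1]}(a↔b) − μ_{K[aa'↦1]}(j↔b)`, `V(A) = μ_{K[a₁a₂,a₁a₃↦1]}(a₁↔b) − μ_{K[…]}(j↔b)`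
  (`KNGoodTwoTwo.agood_oneLayer_ge` + `UpsetExchange.forcedMargin_eq`).  With `H_i = x_i + y_i − x_iy_i` this is the closed form `T(j)` of the
  merged two-star observer used by `KNGoodGC3.gc3_middle` / `gc3_top`.
[cite: KozmaNitzan2024, §3.2 Definition (p. 12), proof of Thm. 4 (pp. 13–14), Lemma 5 (p. 13)]
-/

noncomputable section

namespace Summit.CriticalPhenomena.PercolationContinuityZ3.Theorems

open MeasureTheory Set Literature.Probability.LatticeModels Literature.Probability.Percolation
open scoped Classical BigOperators

variable {n : ℕ}

namespace KNGoodGC3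

open ChampionStability KNGoodAux KNGoodHair KNGoodSeries UpsetExchange KNGoodTwoTwo

/-- The pattern sum of a three-port star, written out. [folklore] -/
theorem sum_pattern_three (a₁ a₂ a₃ : Fin n) (h12 : a₁ ≠ a₂) (h13 : a₁ ≠ a₃) (h23 : a₂ ≠ a₃)
    (h : Fin n → ℝ) (g : Finset (Fin n) → ℝ) :
    ∑ B ∈ ({a₁, a₂, a₃} : Finset (Fin n)).powerset,
        ((∏ p ∈ B, h p) * ∏ u ∈ ({a₁, a₂, a₃} : Finset (Fin n)) \ B, (1 - h u)) * g B =
      (1 - h a₁) * (1 - h a₂) * (1 - h a₃) * g ∅ + h a₁ * (1 - h a₂) * (1 - h a₃) * g {a₁} +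
        (1 - h a₁) * h a₂ * (1 - h a₃) * g {a₂} + (1 - h a₁) * (1 - h a₂) * h a₃ * g {a₃} +
        h a₁ * h a₂ * (1 - h a₃) * g {a₁, a₂} + h a₁ * (1 - h a₂) * h a₃ * g {a₁, a₃} +
        (1 - h a₁) * h a₂ * h a₃ * g {a₂, a₃} + h a₁ * h a₂ * h a₃ * g {a₁, a₂, a₃} := by
  have hn1 : a₁ ∉ ({a₂, a₃} : Finset (Fin n)) := by simp [h12, h13]
  have hn2 : a₂ ∉ ({a₃} : Finset (Fin n)) := by simp [h23]
  rw [Finset.sum_powerset_insert hn1, Finset.sum_powerset_insert hn2, Finset.sum_powerset_insert hn2]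
  have h3 : ∀ F : Finset (Fin n) → ℝ, ∑ t ∈ ({a₃} : Finset (Fin n)).powerset, F t = F ∅ + F {a₃} := by
    intro F
    rw [← insert_empty_eq, Finset.sum_powerset_insert (Finset.notMem_empty a₃), Finset.powerset_empty,
      Finset.sum_singleton, Finset.sum_singleton, insert_empty_eq]
  rw [h3, h3, h3, h3]
  simp only [insert_empty_eq]
  -- evaluate the eight pattern weights
  have P : ({a₁, a₂, a₃} : Finset (Fin n)) = insert a₁ (insert a₂ {a₃}) := rfl
  have d0 : ({a₁, a₂, a₃} : Finset (Fin n)) \ ∅ = {a₁, a₂, a₃} := Finset.sdiff_empty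
  have d3 : ({a₁, a₂, a₃} : Finset (Fin n)) \ {a₃} = {a₁, a₂} := by
    ext z; simp only [Finset.mem_sdiff, Finset.mem_insert, Finset.mem_singleton]
    constructor
    · rintro ⟨h | h | h, hz⟩
      · exact Or.inl h
      · exact Or.inr h
      · exact absurd h hz
    · rintro (h | h)
      · exact ⟨Or.inl h, by rw [h]; exact h13⟩
      · exact ⟨Or.inr (Or.inl h), by rw [h]; exact h23⟩
  have d2 : ({a₁, a₂, a₃} : Finset (Fin n)) \ {a₂} = {a₁, a₃} := by
    ext z; simp only [Finset.mem_sdiff, Finset.mem_insert, Finset.mem_singleton]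
    constructor
    · rintro ⟨h | h | h, hz⟩
      · exact Or.inl h
      · exact absurd h hz
      · exact Or.inr h
    · rintro (h | h)
      · exact ⟨Or.inl h, by rw [h]; exact h12⟩
      · exact ⟨Or.inr (Or.inr h), by rw [h]; exact fun e => h23 e.symm⟩
  have d23 : ({a₁, a₂, a₃} : Finset (Fin n)) \ {a₂, a₃} = {a₁} := by
    ext z; simp only [Finset.mem_sdiff, Finset.mem_insert, Finset.mem_singleton]
    constructor
    · rintro ⟨h | h | h, hz⟩
      · exact h
      · exact absurd (Or.inl h) hz
      · exact absurd (Or.inr h) hz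
    · intro h
      exact ⟨Or.inl h, by rw [h]; rintro (e | e); exact h12 e; exact h13 e⟩
  have d1 : ({a₁, a₂, a₃} : Finset (Fin n)) \ {a₁} = {a₂, a₃} := by
    ext z; simp only [Finset.mem_sdiff, Finset.mem_insert, Finset.mem_singleton]
    constructor
    · rintro ⟨h | h | h, hz⟩
      · exact absurd h hz
      · exact Or.inl h
      · exact Or.inr h
    · rintro (h | h)
      · exact ⟨Or.inr (Or.inl h), by rw [h]; exact fun e => h12 e.symm⟩
      · exact ⟨Or.inr (Or.inr h), by rw [h]; exact fun e => h13 e.symm⟩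
  have d13 : ({a₁, a₂, a₃} : Finset (Fin n)) \ {a₁, a₃} = {a₂} := by
    ext z; simp only [Finset.mem_sdiff, Finset.mem_insert, Finset.mem_singleton]
    constructor
    · rintro ⟨h | h | h, hz⟩
      · exact absurd (Or.inl h) hz
      · exact h
      · exact absurd (Or.inr h) hz
    · intro h
      exact ⟨Or.inr (Or.inl h), by rw [h]; rintro (e | e); exact h12 e.symm; exact h23 e⟩
  have d12 : ({a₁, a₂, a₃} : Finset (Fin n)) \ {a₁, a₂} = {a₃} := by
    ext z; simp only [Finset.mem_sdiff, Finset.mem_insert, Finset.mem_singleton]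
    constructor
    · rintro ⟨h | h | h, hz⟩
      · exact absurd (Or.inl h) hz
      · exact absurd (Or.inr h) hz
      · exact h
    · intro h
      exact ⟨Or.inr (Or.inr h), by rw [h]; rintro (e | e); exact h13 e.symm; exact h23 e.symm⟩
  have d123 : ({a₁, a₂, a₃} : Finset (Fin n)) \ {a₁, a₂, a₃} = ∅ := Finset.sdiff_self _
  rw [d0, d3, d2, d23, d1, d13, d12, d123]
  have hn13 : a₁ ∉ ({a₃} : Finset (Fin n)) := by simp [h13]
  have hn12 : a₁ ∉ ({a₂} : Finset (Fin n)) := by simp [h12]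
  simp only [Finset.prod_empty, Finset.prod_singleton, Finset.prod_insert hn1, Finset.prod_insert hn2,
    Finset.prod_insert hn13, Finset.prod_insert hn12]
  ring



/-- **Eight-term lower bound for the goodness functional of a three-port one-layer observer.**  `x ∉ A` with ports
`a₁, a₂, a₃ ∈ A` (distinct), all other pairs at `x` (and the loop) of weight `0` in `N`; `K` = `N` with `x` killed; `j ∈ A`, `b ≠ x`.
With `H_i = N s(x,a_i)` and `K_S` = `K` with the pairs of `S` made sure:
`agood(N, x; j) ≥ Σ_B π_H(B)·V(B)` written out, the forced-star margins being evaluated through `UpsetExchange.forcedMargin_eq`.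
[cite: KozmaNitzan2024, §3.2 Definition (p. 12), proof of Thm. 4 (pp. 13–14)] -/
theorem agood_threePort_ge (N : Sym2 (Fin n) → unitInterval) (A : Finset (Fin n)) (hA : A.Nonempty)
    (x b a₁ a₂ a₃ j : Fin n) (h12 : a₁ ≠ a₂) (h13 : a₁ ≠ a₃) (h23 : a₂ ≠ a₃)
    (hxA : x ∉ A) (ha₁ : a₁ ∈ A) (ha₂ : a₂ ∈ A) (ha₃ : a₃ ∈ A) (hjA : j ∈ A) (hbx : b ≠ x)
    (hiso : ∀ z : Fin n, z ≠ x → z ∉ ({a₁, a₂, a₃} : Finset (Fin n)) → N s(x, z) = 0) (hloop : N s(x, x) = 0)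
    (K : Sym2 (Fin n) → unitInterval) (hK : K = fun e => if x ∈ e then 0 else N e) :
    (1 - (N s(x, a₁) : ℝ)) * (1 - (N s(x, a₂) : ℝ)) * (1 - (N s(x, a₃) : ℝ)) *
        (A.inf' hA (fun a => (prodBernoulli K).real (openConn a b)) - (prodBernoulli K).real (openConn j b)) +
      (N s(x, a₁) : ℝ) * (1 - (N s(x, a₂) : ℝ)) * (1 - (N s(x, a₃) : ℝ)) *
        ((prodBernoulli K).real (openConn a₁ b) - (prodBernoulli K).real (openConn j b)) +
      (1 - (N s(x, a₁) : ℝ)) * (N s(x, a₂) : ℝ) * (1 - (N s(x, a₃) : ℝ)) *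
        ((prodBernoulli K).real (openConn a₂ b) - (prodBernoulli K).real (openConn j b)) +
      (1 - (N s(x, a₁) : ℝ)) * (1 - (N s(x, a₂) : ℝ)) * (N s(x, a₃) : ℝ) *
        ((prodBernoulli K).real (openConn a₃ b) - (prodBernoulli K).real (openConn j b)) +
      (N s(x, a₁) : ℝ) * (N s(x, a₂) : ℝ) * (1 - (N s(x, a₃) : ℝ)) *
        ((prodBernoulli (fun f : Sym2 (Fin n) => if f ∈ ({s(a₁, a₂)} : Finset (Sym2 (Fin n))) then 1 else K f)).real (openConn a₁ b) -
          (prodBernoulli (fun f : Sym2 (Fin n) => if f ∈ ({s(a₁, a₂)} : Finset (Sym2 (Fin n))) then 1 else K f)).real (openConn j b)) +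
      (N s(x, a₁) : ℝ) * (1 - (N s(x, a₂) : ℝ)) * (N s(x, a₃) : ℝ) *
        ((prodBernoulli (fun f : Sym2 (Fin n) => if f ∈ ({s(a₁, a₃)} : Finset (Sym2 (Fin n))) then 1 else K f)).real (openConn a₁ b) -
          (prodBernoulli (fun f : Sym2 (Fin n) => if f ∈ ({s(a₁, a₃)} : Finset (Sym2 (Fin n))) then 1 else K f)).real (openConn j b)) +
      (1 - (N s(x, a₁) : ℝ)) * (N s(x, a₂) : ℝ) * (N s(x, a₃) : ℝ) *
        ((prodBernoulli (fun f : Sym2 (Fin n) => if f ∈ ({s(a₂, a₃)} : Finset (Sym2 (Fin n))) then 1 else K f)).real (openConn a₂ b) -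
          (prodBernoulli (fun f : Sym2 (Fin n) => if f ∈ ({s(a₂, a₃)} : Finset (Sym2 (Fin n))) then 1 else K f)).real (openConn j b)) +
      (N s(x, a₁) : ℝ) * (N s(x, a₂) : ℝ) * (N s(x, a₃) : ℝ) *
        ((prodBernoulli (fun f : Sym2 (Fin n) => if f ∈ ({s(a₁, a₂), s(a₁, a₃)} : Finset (Sym2 (Fin n))) then 1 else K f)).real (openConn a₁ b) -
          (prodBernoulli (fun f : Sym2 (Fin n) => if f ∈ ({s(a₁, a₂), s(a₁, a₃)} : Finset (Sym2 (Fin n))) then 1 else K f)).real (openConn j b)) ≤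
      (prodBernoulli N).real (openConn x b) - (prodBernoulli N).real (openConn j b) +
        ∑ W' ∈ nullSets A, (prodBernoulli N).real (clusterIs x W') *
          A.inf' hA (fun a => (prodBernoulli N).real (openConnIn ((↑W' : Set (Fin n))ᶜ) a b)) := by
  have hxa₁ : x ≠ a₁ := fun h => hxA (h ▸ ha₁)
  have hxa₂ : x ≠ a₂ := fun h => hxA (h ▸ ha₂)
  have hxa₃ : x ≠ a₃ := fun h => hxA (h ▸ ha₃)
  have hjx : j ≠ x := fun h => hxA (h ▸ hjA)
  have hPA : ({a₁, a₂, a₃} : Finset (Fin n)) ⊆ A := by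
    intro z hz; simp only [Finset.mem_insert, Finset.mem_singleton] at hz
    rcases hz with rfl | rfl | rfl <;> assumption
  have hexp := agood_oneLayer_ge N A {a₁, a₂, a₃} hA x j b hxA hPA hbx hiso hloop K hK
  rw [sum_pattern_three a₁ a₂ a₃ h12 h13 h23 (fun p => (N s(x, p) : ℝ))] at hexp
  -- evaluate the forced margins
  have hisoK : ∀ u : Fin n, u ≠ x → K s(x, u) = 0 := fun u _ => by rw [hK]; simp
  have hx1 : x ∉ ({a₁} : Finset (Fin n)) := by simp [hxa₁]
  have hx2 : x ∉ ({a₂} : Finset (Fin n)) := by simp [hxa₂]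
  have hx3 : x ∉ ({a₃} : Finset (Fin n)) := by simp [hxa₃]
  have hx12 : x ∉ ({a₁, a₂} : Finset (Fin n)) := by simp [hxa₁, hxa₂]
  have hx13 : x ∉ ({a₁, a₃} : Finset (Fin n)) := by simp [hxa₁, hxa₃]
  have hx23 : x ∉ ({a₂, a₃} : Finset (Fin n)) := by simp [hxa₂, hxa₃]
  have hx123 : x ∉ ({a₁, a₂, a₃} : Finset (Fin n)) := by simp [hxa₁, hxa₂, hxa₃]
  -- single ports: S = ∅
  have hK0 : (fun f : Sym2 (Fin n) => if f ∈ (∅ : Finset (Sym2 (Fin n))) then (1 : unitInterval) else K f) = K := by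
    funext f; simp
  have m1 := forcedMargin_eq K x b j hisoK hbx hjx {a₁} hx1 a₁ (by simp) ∅ (by simp) (by simp)
  have m2 := forcedMargin_eq K x b j hisoK hbx hjx {a₂} hx2 a₂ (by simp) ∅ (by simp) (by simp)
  have m3 := forcedMargin_eq K x b j hisoK hbx hjx {a₃} hx3 a₃ (by simp) ∅ (by simp) (by simp)
  rw [hK0] at m1 m2 m3
  -- pairs
  have hS12 : ∀ e ∈ ({s(a₁, a₂)} : Finset (Sym2 (Fin n))), ∀ z ∈ e, z ∈ ({a₁, a₂} : Finset (Fin n)) := by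
    intro e he z hz; rw [Finset.mem_singleton] at he; subst he
    rcases Sym2.mem_iff.1 hz with rfl | rfl <;> simp
  have hS13 : ∀ e ∈ ({s(a₁, a₃)} : Finset (Sym2 (Fin n))), ∀ z ∈ e, z ∈ ({a₁, a₃} : Finset (Fin n)) := by
    intro e he z hz; rw [Finset.mem_singleton] at he; subst he
    rcases Sym2.mem_iff.1 hz with rfl | rfl <;> simp
  have hS23 : ∀ e ∈ ({s(a₂, a₃)} : Finset (Sym2 (Fin n))), ∀ z ∈ e, z ∈ ({a₂, a₃} : Finset (Fin n)) := by
    intro e he z hz; rw [Finset.mem_singleton] at he; subst he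
    rcases Sym2.mem_iff.1 hz with rfl | rfl <;> simp
  have m12 := forcedMargin_eq K x b j hisoK hbx hjx {a₁, a₂} hx12 a₁ (by simp) {s(a₁, a₂)} hS12
    (by intro t ht; simp only [Finset.mem_insert, Finset.mem_singleton] at ht
        rcases ht with rfl | rfl
        · exact Or.inl rfl
        · exact Or.inr (Or.inl (by simp)))
  have m13 := forcedMargin_eq K x b j hisoK hbx hjx {a₁, a₃} hx13 a₁ (by simp) {s(a₁, a₃)} hS13
    (by intro t ht; simp only [Finset.mem_insert, Finset.mem_singleton] at ht
        rcases ht with rfl | rfl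
        · exact Or.inl rfl
        · exact Or.inr (Or.inl (by simp)))
  have m23 := forcedMargin_eq K x b j hisoK hbx hjx {a₂, a₃} hx23 a₂ (by simp) {s(a₂, a₃)} hS23
    (by intro t ht; simp only [Finset.mem_insert, Finset.mem_singleton] at ht
        rcases ht with rfl | rfl
        · exact Or.inl rfl
        · exact Or.inr (Or.inl (by simp)))
  -- the triple
  have hS123 : ∀ e ∈ ({s(a₁, a₂), s(a₁, a₃)} : Finset (Sym2 (Fin n))), ∀ z ∈ e, z ∈ ({a₁, a₂, a₃} : Finset (Fin n)) := by
    intro e he z hz; simp only [Finset.mem_insert, Finset.mem_singleton] at he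
    rcases he with rfl | rfl <;> rcases Sym2.mem_iff.1 hz with rfl | rfl <;> simp
  have m123 := forcedMargin_eq K x b j hisoK hbx hjx {a₁, a₂, a₃} hx123 a₁ (by simp) {s(a₁, a₂), s(a₁, a₃)} hS123
    (by intro t ht; simp only [Finset.mem_insert, Finset.mem_singleton] at ht
        rcases ht with rfl | rfl | rfl
        · exact Or.inl rfl
        · exact Or.inr (Or.inl (by simp))
        · exact Or.inr (Or.inl (by simp)))
  simp only [Finset.insert_ne_empty, Finset.singleton_ne_empty, if_false, if_true] at hexp
  rw [m1, m2, m3, m12, m13, m23, m123] at hexp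
  exact hexp

end KNGoodGC3

end Summit.CriticalPhenomena.PercolationContinuityZ3.Theorems

end
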